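import Literature.NumberTheory.EllipticCurves.HeegnerPointsKolyvaginPrimaryLeavesProofs
import HarnessLib

/-!
# Kolyvagin's descent data modulo `p^M` from the leaves, with the dictionary exposed

Sibling proof file of `HeegnerPointsKolyvaginPrimaryLeavesProofs`, whose
`KolyvaginDescent.exists_hypothesesM_of_leavesM` produces the abstract descent data
`S : KolyvaginDescent.HypothesesM (H¹(K, E[p^M])) _` from the two mod-`p^M` Euler-system leaves but
exposes only `S.Sel`, `S.x`, `S.p`, `S.M₀`, `S.M`. Consumers that discharge FURTHER hypotheses of the
abstract theory at the concrete data — the kernel-form Čebotarev input `hCeb`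
(`HeegnerPointsKolyvaginPrimaryOrderCebProofs`: needs `S.τ = c_*`, `S.Kol`, `S.A`) and the
Cassels–Tate value formula `hCTV` of Kolyvagin's order bound
(`HeegnerPointsKolyvaginPrimaryOrderTelescopeProofs`: needs `S.c = c_M`, `S.ε`, `S.A`) — need the
rest of the dictionary. This file re-runs the SAME construction and records it:

* `KolyvaginDescent.exists_hypothesesM_of_leavesM_dictionary` — as `exists_hypothesesM_of_leavesM`,
  plus `S.τ = c_*`, `S.Kol ℓ ↔ IsKolyvaginPrime N W K p ℓ ∧ FrobEqFrobInfty W K (p^M) ℓ`,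
  `g ∈ S.A ℓ ↔ ∀ v ∋ ℓ, g_v = 0`, `S.c = cl`, `S.ε = ε`.

Proof: verbatim that of `exists_hypothesesM_of_leavesM` (the structure literal is the same), the
new conjuncts holding by `rfl` / `AddSubgroup.mem_iInf`. No named fact is introduced.

## References

* W. G. McCallum, *Kolyvagin's work on Shafarevich–Tate groups*, LMS Lecture Note Ser. 153
  (1991), 295–316: §4 (6), Lemma 4.3, Prop. 4.4; §5 Lemma 5.1, Lemma 5.3. [McCallumLMS1991]
* B. H. Gross, *Kolyvagin's work on modular elliptic curves*, same volume, Props. 5.3, 5.4 (2).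
  [GrossLMS1991]
-/

noncomputable section

open scoped Classical
open WeierstrassCurve NumberField IsDedekindDomain
open Literature.NumberTheory.GaloisRepresentations

universe u

namespace Literature.NumberTheory.EllipticCurves

namespace KolyvaginDescent

section Leaves

variable {N : ℕ} [NeZero N] {W : WeierstrassCurve ℚ} {K : Type u} [Field K] [NumberField K]

/-- **`KolyvaginDescent.HypothesesM` from the two mod-`p^M` leaves, with the dictionary** — the
statement of `exists_hypothesesM_of_leavesM` (same hypotheses: (A) Kolyvagin's classes `c_M(n)` with
McCallum (6), Lemma 4.3, Prop. 4.4, Gross Props. 5.3 / 5.4 (2); (B) Lemma 5.3 with Prop. 2.2; the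
Čebotarev density theorem and the Weil pairing) extended by the identities `S.τ = c_*`,
`S.Kol ℓ ↔ IsKolyvaginPrime N W K p ℓ ∧ FrobEqFrobInfty W K (p^M) ℓ`,
`g ∈ S.A ℓ ↔ (∀ v ∋ ℓ, g_v = 0)`, `S.c = c_M`, `S.ε = ε`.
[cite: McCallumLMS1991, §4 (6), Lemma 4.3, Prop. 4.4; §5 Lemma 5.1, Lemma 5.3]
[cite: GrossLMS1991, Props. 5.3, 5.4 (2)] -/
theorem exists_hypothesesM_of_leavesM_dictionary [W.IsElliptic] (hK : IsImaginaryQuadratic K)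
    {P : (W.baseChange K).toAffine.Point} {p : ℕ} (hp : p.Prime) (hp2 : p ≠ 2)
    (hρ : W.HasSurjectiveModNGaloisRep p) (hC : Automorphic.chebotarev_artinRep)
    (hW : W.exists_weilPairing p) {M : ℕ} (hM : 1 ≤ M)
    (hdiv : ∀ Q : geomPoints (W.baseChange K), ∃ R, ((p ^ M : ℕ) : ℤ) • R = Q)
    {c : K ≃ₐ[ℚ] K} (hc : c ≠ 1) (hcc : c * c = 1)
    {M₀ : ℕ} {x₀ : (W.baseChange K).toAffine.Point} (hx₀ : p ^ M₀ • x₀ = P)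
    (hPx : kummerMapTorsion (W.baseChange K) _ hdiv P =
      ((p : ℤ) ^ M₀) • kummerMapTorsion (W.baseChange K) _ hdiv x₀)
    (hxord : ((p : ℤ) ^ (M - 1)) • kummerMapTorsion (W.baseChange K) _ hdiv x₀ ≠ 0)
    (ε : ℤ) (hε : ε = 1 ∨ ε = -1)
    (h53 : IsOfFinAddOrder (Affine.Point.map (W' := W) (c : K →ₐ[ℚ] K) P - ε • P))
    (cl : ℕ → galH1Torsion (W.baseChange K) ((p ^ M : ℕ) : ℤ))
    (hc1 : cl 1 = kummerMapTorsion (W.baseChange K) _ hdiv P)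
    (hcl : ∀ m : ℕ, Squarefree m →
      (∀ q ∈ m.primeFactors, IsKolyvaginPrime N W K p q ∧ FrobEqFrobInfty W K (p ^ M) q) →
      conjAct W c _ (cl m) = (ε * (-1) ^ m.primeFactors.card) • cl m ∧
      (∀ v : HeightOneSpectrum (𝓞 K), (m : 𝓞 K) ∉ v.asIdeal →
        cl m ∈ selmerLocalKer (W.baseChange K) (v.adicCompletion K) ((p ^ M : ℕ) : ℤ)) ∧
      (∀ ℓ : ℕ, ℓ.Prime → ℓ ∣ m → ∀ v : HeightOneSpectrum (𝓞 K), (ℓ : 𝓞 K) ∈ v.asIdeal →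
        ∀ a : ℕ, (((p : ℤ) ^ a) • cl m ∈
            selmerLocalKer (W.baseChange K) (v.adicCompletion K) ((p ^ M : ℕ) : ℤ) ↔
          ((p : ℤ) ^ a) • cl (m / ℓ) ∈
            (W.baseChange K).torsionLocalKer (v.adicCompletion K) ((p ^ M : ℕ) : ℤ))))
    (hdual : ∀ ℓ : ℕ, IsKolyvaginPrime N W K p ℓ ∧ FrobEqFrobInfty W K (p ^ M) ℓ →
      ∀ ν : ℤ, (ν = 1 ∨ ν = -1) → ∀ d : galH1Torsion (W.baseChange K) ((p ^ M : ℕ) : ℤ),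
      conjAct W c _ d = ν • d →
      (∀ v : HeightOneSpectrum (𝓞 K), (ℓ : 𝓞 K) ∉ v.asIdeal →
        d ∈ selmerLocalKer (W.baseChange K) (v.adicCompletion K) ((p ^ M : ℕ) : ℤ)) →
      (∀ w : InfinitePlace K, d ∈ selmerLocalKer (W.baseChange K) w.Completion ((p ^ M : ℕ) : ℤ)) →
      ∀ s ∈ selmerGroup (W.baseChange K) ((p ^ M : ℕ) : ℤ), conjAct W c _ s = ν • s →
      ∀ a : ℕ, a < M → ∀ v : HeightOneSpectrum (𝓞 K), (ℓ : 𝓞 K) ∈ v.asIdeal →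
        ((p : ℤ) ^ a) • d ∉ selmerLocalKer (W.baseChange K) (v.adicCompletion K) ((p ^ M : ℕ) : ℤ) →
        ((p : ℤ) ^ (M - 1 - a)) • s ∈
          (W.baseChange K).torsionLocalKer (v.adicCompletion K) ((p ^ M : ℕ) : ℤ)) :
    ∃ S : HypothesesM (galH1Torsion (W.baseChange K) ((p ^ M : ℕ) : ℤ))
        (HeightOneSpectrum (𝓞 K) ⊕ InfinitePlace K),
      S.Sel = selmerGroup (W.baseChange K) ((p ^ M : ℕ) : ℤ) ∧
      S.x = kummerMapTorsion (W.baseChange K) _ hdiv x₀ ∧ S.p = p ∧ S.M₀ = M₀ ∧ S.M = M ∧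
      (∀ g, S.τ g = conjAct W c ((p ^ M : ℕ) : ℤ) g) ∧
      (∀ ℓ, S.Kol ℓ ↔ IsKolyvaginPrime N W K p ℓ ∧ FrobEqFrobInfty W K (p ^ M) ℓ) ∧
      (∀ ℓ g, g ∈ S.A ℓ ↔ ∀ v : HeightOneSpectrum (𝓞 K), (ℓ : 𝓞 K) ∈ v.asIdeal →
        g ∈ (W.baseChange K).torsionLocalKer (v.adicCompletion K) ((p ^ M : ℕ) : ℤ)) ∧
      (∀ n, S.c n = cl n) ∧ S.ε = ε := by
  have hn0 : ((p ^ M : ℕ) : ℤ) ≠ 0 := by exact_mod_cast pow_ne_zero M hp.ne_zero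
  -- `E(K)[p] = 0`
  have hbot := torsionBy_eq_bot_of_isImaginaryQuadratic W K hK hp hp2 hρ
  have hA : ∀ a : (W.baseChange K).toAffine.Point, p • a = 0 → a = 0 := fun a ha ↦ by
    have : a ∈ AddSubgroup.torsionBy (W.baseChange K).toAffine.Point (p : ℤ) := by
      rw [mem_torsionBy_iff, natCast_zsmul]; exact ha
    rw [hbot] at this
    exact this
  -- `τ x = ε x`
  set x := kummerMapTorsion (W.baseChange K) _ hdiv x₀ with hxdef
  have hεε : ε * ε = 1 := by rcases hε with rfl | rfl <;> norm_num
  have hτx : conjAct W c _ x = ε • x := by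
    rw [hxdef, conjAct_kummerMapTorsion W c _ hdiv x₀]
    -- `t = c x₀ - ε x₀` is torsion
    set t := Affine.Point.map (W' := W) (c : K →ₐ[ℚ] K) x₀ - ε • x₀ with ht
    have htP : p ^ M₀ • t = Affine.Point.map (W' := W) (c : K →ₐ[ℚ] K) P - ε • P := by
      rw [ht, smul_sub, ← map_nsmul, hx₀, smul_comm, hx₀]
    have htors : IsOfFinAddOrder t := by
      obtain ⟨k, hk, hkt⟩ := (isOfFinAddOrder_iff_nsmul_eq_zero).mp h53
      refine (isOfFinAddOrder_iff_nsmul_eq_zero).mpr ⟨k * p ^ M₀, Nat.mul_pos hk (pow_pos hp.pos _), ?_⟩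
      rw [mul_smul, htP, hkt]
    obtain ⟨s, hs⟩ := exists_pow_smul_eq_of_isOfFinAddOrder hp hA htors M
    have hker : t ∈ (kummerMapTorsion (W.baseChange K) ((p ^ M : ℕ) : ℤ) hdiv).ker := by
      rw [kummerMapTorsion_ker]
      exact ⟨s, by rw [← hs, Nat.cast_pow]; rfl⟩
    have ht0 : kummerMapTorsion (W.baseChange K) _ hdiv t = 0 := hker
    have : Affine.Point.map (W' := W) (c : K →ₐ[ℚ] K) x₀ = t + ε • x₀ := by rw [ht]; abel
    rw [this, map_add, ht0, zero_add, map_zsmul]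
  -- the local conditions at the (complex) infinite places are empty
  have hinf : ∀ (w : InfinitePlace K) (y : galH1Torsion (W.baseChange K) ((p ^ M : ℕ) : ℤ)),
      y ∈ selmerLocalKer (W.baseChange K) w.Completion ((p ^ M : ℕ) : ℤ) := fun w y ↦ by
    haveI : IsAlgClosed w.Completion :=
      isAlgClosed_of_ringEquiv (InfinitePlace.Completion.ringEquivComplexOfIsComplex
        (hK.2.isComplex w)).symm
    rw [WeierstrassCurve.selmerLocalKer_eq_top_of_isAlgClosed]
    trivial
  -- the structure
  refine ⟨
    { p := p
      hp := hp
      hp2 := hp2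
      M := M
      torsion := fun v ↦ by
        have := zsmul_discreteH1_torsion ((p ^ M : ℕ) : ℤ) v
        exact_mod_cast this
      τ := conjAct W c _
      τ_τ := conjAct_conjAct_of_mul_self W hcc _
      Sel := selmerGroup (W.baseChange K) _
      τ_mem := fun s hs ↦ conjAct_mem_selmerGroup W hK.2.isComplex c _ hs
      Loc := Sum.elim (fun v ↦ selmerLocalKer (W.baseChange K) (v.adicCompletion K) _)
        (fun w ↦ selmerLocalKer (W.baseChange K) w.Completion _)
      mem_sel_iff := fun s ↦ by rw [mem_selmerGroup_iff, Sum.forall]; rfl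
      Kol := fun ℓ ↦ IsKolyvaginPrime N W K p ℓ ∧ FrobEqFrobInfty W K (p ^ M) ℓ
      prime_of_kol := fun ℓ h ↦ h.1.prime
      pl := fun ℓ ↦ if h : IsKolyvaginPrime N W K p ℓ ∧ FrobEqFrobInfty W K (p ^ M) ℓ then
          Sum.inl h.1.place else Sum.inr (Classical.arbitrary _)
      Dv := fun v n ↦ Sum.elim (fun v ↦ (n : 𝓞 K) ∈ v.asIdeal) (fun _ ↦ False) v
      dv_iff := fun ℓ hℓ v ↦ by
        rw [dif_pos hℓ]
        rcases v with v | w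
        · simp only [Sum.elim_inl, Sum.inl.injEq]
          exact hℓ.1.mem_iff
        · simp
      dv_mul := fun ℓ ℓ' _ _ v ↦ by
        rcases v with v | w
        · exact natCast_mul_mem_asIdeal
        · simp
      A := fun ℓ ↦ ⨅ (v : HeightOneSpectrum (𝓞 K)) (_ : (ℓ : 𝓞 K) ∈ v.asIdeal),
        (W.baseChange K).torsionLocalKer (v.adicCompletion K) _
      x := x
      x_mem := (mem_selmerGroup_iff _ _ _).mpr
        ⟨fun _ ↦ kummerMapTorsion_mem_selmerLocalKer _ _ _ _ x₀,
          fun _ ↦ kummerMapTorsion_mem_selmerLocalKer _ _ _ _ x₀⟩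
      x_ord := hxord
      M₀ := M₀
      ε := ε
      hε := hε
      τ_x := hτx
      c := cl
      c_one := by rw [hc1, hPx]
      τ_c := fun n hn ↦ (hcl n hn.1 hn.2).1
      c_mem_loc := fun n hn v hv ↦ by
        rcases v with v | w
        · exact (hcl n hn.1 hn.2).2.1 v hv
        · exact hinf w (cl n)
      c_mem_loc_iff := fun ℓ m hℓ hn a ↦ by
        rw [dif_pos hℓ]
        simp only [Sum.elim_inl, AddSubgroup.mem_iInf]
        have key := (hcl (ℓ * m) hn.1 hn.2).2.2 ℓ hℓ.1.prime (dvd_mul_right ℓ m) hℓ.1.place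
          hℓ.1.mem_place a
        rw [Nat.mul_div_cancel_left m hℓ.1.prime.pos] at key
        rw [key]
        constructor
        · intro h v hv
          rwa [hℓ.1.mem_iff.mp hv]
        · intro h
          exact h hℓ.1.place hℓ.1.mem_place
      duality := fun ℓ hℓ ν hν d hd hoff s hs hτs a ha hat ↦ by
        rw [dif_pos hℓ] at hoff hat
        simp only [AddSubgroup.mem_iInf]
        intro v hv
        refine hdual ℓ hℓ ν hν d hd (fun v' hv' ↦ ?_) (fun w ↦ ?_) s hs hτs a ha v hv ?_
        · exact hoff (Sum.inl v') (fun h ↦ hv' (hℓ.1.mem_iff.mpr (Sum.inl_injective h)))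
        · exact hoff (Sum.inr w) (by simp)
        · rwa [hℓ.1.mem_iff.mp hv]
      cebotarev := fun r cs Nv h0 hN hτ hind b ↦ by
        obtain ⟨ℓ, hlt, hKol, hfrob, hloc⟩ := McCallum1991_cor_3_2_pow_of_chebotarev (N := N) hC hK
          hp hp2 hρ hW hM hc cs h0 Nv hN hτ hind b
        refine ⟨ℓ, hlt, ⟨hKol, hfrob⟩, fun i ↦ ⟨?_, fun hNi h ↦ ?_⟩⟩
        · simp only [AddSubgroup.mem_iInf]
          intro v hv
          exact (hloc i v hv).1
        · simp only [AddSubgroup.mem_iInf] at h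
          exact (hloc i hKol.place hKol.mem_place).2 hNi (h hKol.place hKol.mem_place) },
    rfl, rfl, rfl, rfl, rfl, fun g ↦ rfl, fun ℓ ↦ Iff.rfl, fun ℓ g ↦ by simp only [AddSubgroup.mem_iInf],
    fun n ↦ rfl, rfl⟩


/-- **The dictionary at a level written `n = p^M`.** Same statement as
`exists_hypothesesM_of_leavesM_dictionary`, with the torsion level `p^M` of `H¹(K, E[p^M])`, of the
Kolyvagin primes (`FrobEqFrobInfty W K n`) and of the local kernels written as a natural number `n`
with `n = p^M` supplied as a hypothesis — so that consumers working at a level presented as a product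
(`n = m · m`, `m = p^{M₀}`, `M = 2M₀`: the auxiliary level of the Cassels–Tate files
`CasselsTateSelmer*`) can instantiate it without transporting structures along `p^(2M₀) = p^M₀ · p^M₀`.
Proof: `subst`. [cite: McCallumLMS1991, §4 (6), Lemma 4.3, Prop. 4.4; §5 Lemma 5.1, Lemma 5.3]
[cite: GrossLMS1991, Props. 5.3, 5.4 (2)] -/
theorem exists_hypothesesM_of_leavesM_dictionary_level [W.IsElliptic] (hK : IsImaginaryQuadratic K)
    {P : (W.baseChange K).toAffine.Point} {p : ℕ} (hp : p.Prime) (hp2 : p ≠ 2)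
    (hρ : W.HasSurjectiveModNGaloisRep p) (hC : Automorphic.chebotarev_artinRep)
    (hW : W.exists_weilPairing p) {M : ℕ} (hM : 1 ≤ M) {n : ℕ} (hn : n = p ^ M)
    (hdiv : ∀ Q : geomPoints (W.baseChange K), ∃ R, (n : ℤ) • R = Q)
    {c : K ≃ₐ[ℚ] K} (hc : c ≠ 1) (hcc : c * c = 1)
    {M₀ : ℕ} {x₀ : (W.baseChange K).toAffine.Point} (hx₀ : p ^ M₀ • x₀ = P)
    (hPx : kummerMapTorsion (W.baseChange K) _ hdiv P =
      ((p : ℤ) ^ M₀) • kummerMapTorsion (W.baseChange K) _ hdiv x₀)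
    (hxord : ((p : ℤ) ^ (M - 1)) • kummerMapTorsion (W.baseChange K) _ hdiv x₀ ≠ 0)
    (ε : ℤ) (hε : ε = 1 ∨ ε = -1)
    (h53 : IsOfFinAddOrder (Affine.Point.map (W' := W) (c : K →ₐ[ℚ] K) P - ε • P))
    (cl : ℕ → galH1Torsion (W.baseChange K) (n : ℤ))
    (hc1 : cl 1 = kummerMapTorsion (W.baseChange K) _ hdiv P)
    (hcl : ∀ m : ℕ, Squarefree m →
      (∀ q ∈ m.primeFactors, IsKolyvaginPrime N W K p q ∧ FrobEqFrobInfty W K n q) →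
      conjAct W c _ (cl m) = (ε * (-1) ^ m.primeFactors.card) • cl m ∧
      (∀ v : HeightOneSpectrum (𝓞 K), (m : 𝓞 K) ∉ v.asIdeal →
        cl m ∈ selmerLocalKer (W.baseChange K) (v.adicCompletion K) (n : ℤ)) ∧
      (∀ ℓ : ℕ, ℓ.Prime → ℓ ∣ m → ∀ v : HeightOneSpectrum (𝓞 K), (ℓ : 𝓞 K) ∈ v.asIdeal →
        ∀ a : ℕ, (((p : ℤ) ^ a) • cl m ∈
            selmerLocalKer (W.baseChange K) (v.adicCompletion K) (n : ℤ) ↔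
          ((p : ℤ) ^ a) • cl (m / ℓ) ∈
            (W.baseChange K).torsionLocalKer (v.adicCompletion K) (n : ℤ))))
    (hdual : ∀ ℓ : ℕ, IsKolyvaginPrime N W K p ℓ ∧ FrobEqFrobInfty W K n ℓ →
      ∀ ν : ℤ, (ν = 1 ∨ ν = -1) → ∀ d : galH1Torsion (W.baseChange K) (n : ℤ),
      conjAct W c _ d = ν • d →
      (∀ v : HeightOneSpectrum (𝓞 K), (ℓ : 𝓞 K) ∉ v.asIdeal →
        d ∈ selmerLocalKer (W.baseChange K) (v.adicCompletion K) (n : ℤ)) →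
      (∀ w : InfinitePlace K, d ∈ selmerLocalKer (W.baseChange K) w.Completion (n : ℤ)) →
      ∀ s ∈ selmerGroup (W.baseChange K) (n : ℤ), conjAct W c _ s = ν • s →
      ∀ a : ℕ, a < M → ∀ v : HeightOneSpectrum (𝓞 K), (ℓ : 𝓞 K) ∈ v.asIdeal →
        ((p : ℤ) ^ a) • d ∉ selmerLocalKer (W.baseChange K) (v.adicCompletion K) (n : ℤ) →
        ((p : ℤ) ^ (M - 1 - a)) • s ∈
          (W.baseChange K).torsionLocalKer (v.adicCompletion K) (n : ℤ)) :
    ∃ S : HypothesesM (galH1Torsion (W.baseChange K) (n : ℤ))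
        (HeightOneSpectrum (𝓞 K) ⊕ InfinitePlace K),
      S.Sel = selmerGroup (W.baseChange K) (n : ℤ) ∧
      S.x = kummerMapTorsion (W.baseChange K) _ hdiv x₀ ∧ S.p = p ∧ S.M₀ = M₀ ∧ S.M = M ∧
      (∀ g, S.τ g = conjAct W c (n : ℤ) g) ∧
      (∀ ℓ, S.Kol ℓ ↔ IsKolyvaginPrime N W K p ℓ ∧ FrobEqFrobInfty W K n ℓ) ∧
      (∀ ℓ g, g ∈ S.A ℓ ↔ ∀ v : HeightOneSpectrum (𝓞 K), (ℓ : 𝓞 K) ∈ v.asIdeal →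
        g ∈ (W.baseChange K).torsionLocalKer (v.adicCompletion K) (n : ℤ)) ∧
      (∀ n, S.c n = cl n) ∧ S.ε = ε := by
  subst hn
  exact exists_hypothesesM_of_leavesM_dictionary hK hp hp2 hρ hC hW hM hdiv hc hcc hx₀ hPx hxord ε hε
    h53 cl hc1 hcl hdual

end Leaves

end KolyvaginDescent

end Literature.NumberTheory.EllipticCurves

end
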